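import Literature.InformationTheory.QuantumCodes.BivariateBicycleCodes
import HarnessLib

/-!
# The seventh code of Bravyi et al.'s Table 3: `[[756, 16, ≤ 34]]` = `QC(x³+y¹⁰+y¹⁷, y⁵+x³+x¹⁹)` on `ℤ₂₁ × ℤ₁₈`

Bravyi–Cross–Gambetta–Maslov–Rall–Yoder, Nature 627 (2024) [BravyiEtAl2024], Extended Data Table 1
(= arXiv:2308.07915v2 Table 3) lists, after the five codes of `BivariateBicycleCodes.lean` (`bb72` … `bb288`,
distances printed as exact) and the `[[360,12,≤24]]` code of `BivariateBicycleCode360.lean`, a seventh and largest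
code whose distance is printed as an UPPER BOUND only ("The notation `≤d` indicates that only an upper bound on
the code distance is known at the time of this writing", Nature ED Table 1 caption p0011 L6–7):
`[[756, 16, ≤34]]` with `ℓ = 21, m = 18`, `A = x³ + y¹⁰ + y¹⁷`, `B = y⁵ + x³ + x¹⁹`, net encoding rate `1/95`.

This file types that code as DATA (`bb756`), with its qubit count and the printed weight-(3,3) side condition, so
that the structural statements of [BravyiEtAl2024, §5] ("all codes in Table 3": connected Tanner graph, toric
layout) and the kernel `k`-certificate machinery can be instantiated on it Summits-side. Its printed parameters
(`k = 16`; distance `≤ 34`, an upper bound) are a CLAIM, NOT asserted here.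

PAGE GRADE (stated as ruled by the qec lead, 2026-08-27T05:38Z): the body of Extended Data Table 1 is an IMAGE in
the held primary copies (Nature OA PDF; the held arXiv TeX strips the table), so `(ℓ, m, A, B)` of this row rest on
(i) qec-lit-3's two-pass extraction of the arXiv HTML rendering of Table 3 (HOME/lit/BB-TABLE3-arxiv-2308.07915v2.md,
grade provisional-primary: "`756 16 <=34 1/95 21 18 x^3+y^10+y^17 y^5+x^3+x^19`"), (ii) the lit-materialised
SECONDARY page Symons–Rajput–Browne, arXiv:2511.13560, p. 34 L39–40: "the `[[756,16,≤34]]` code shown in [34], which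
can be viewed as a 6-cover code of the `[[126,4,12]]` code `Q(x³+y+y², y²+x³+x¹⁹, 21, 3)`" — consistent with (i):
reducing the `y`-exponents of `A, B` modulo `3` gives exactly `x³+y+y²` and `y²+x³+x¹⁹` on `(ℓ, m) = (21, 3)` — and
(iii) the recomputation `k = 16` (= the printed `k`) from the polynomials (i) by qec-search-8 (census/search-8/
proposals/F-A0.1/BB756.json, 2026-08-27) and in the kernel (`Census/BB/BB756Rank*.lean`). The primary table itself
is qec `WANTED` W1 / acquisition acq-11573 (OPEN at the time of typing); no "as printed" FINDINGS sentence is drawn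
from this object until that page is read.
-/

namespace Literature.InformationTheory.QuantumCodes

namespace BB

/-- The `[[756,16,≤34]]` code of [BravyiEtAl2024, Table 3]: `ℓ = 21, m = 18`, `A = x³ + y¹⁰ + y¹⁷`,
`B = y⁵ + x³ + x¹⁹`. DATA; its printed parameters (`k = 16`, distance `≤ 34`, an upper bound only) are a CLAIM,
not asserted here. `(ℓ, m, A, B)`: arXiv-HTML extraction of Table 3 (provisional-primary, HOME/lit/BB-TABLE3-
arxiv-2308.07915v2.md row 7) + secondary page arXiv:2511.13560 p0034 L39–40 ("6-cover code of the `[[126,4,12]]`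
code `Q(x^3+y+y^2, y^2+x^3+x^19, 21, 3)`", exponents agree mod 3); primary table = WANTED W1 / acq-11573 (open).
[cite: BravyiEtAl2024, Extended Data Table 1 / arXiv Table 3 row [[756,16,≤34]]; SI Table 6 ("Base Order")] -/
def bb756 : Code 21 18 := ⟨xPow 3 + yPow 10 + yPow 17, yPow 5 + xPow 3 + xPow 19⟩

/-- `n = 2ℓm = 756` for `(ℓ, m) = (21, 18)`. Proved (counting).
[cite: BravyiEtAl2024, Extended Data Table 1 / arXiv Table 3 row [[756,16,≤34]]] -/
theorem numQubits_bb756 : numQubits 21 18 = 756 := by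
  simp only [numQubits_eq]

/-- `bb756` satisfies the printed side condition (three distinct powers of `x` or `y` in `A` and in `B`).
[cite: BravyiEtAl2024, §4 (arXiv:2308.07915 chunk p0009 L20–24)] -/
theorem isBBPoly_bb756 : IsBBPoly bb756.A ∧ IsBBPoly bb756.B :=
  ⟨⟨(Fin.ofNat 21 3, 0), (0, Fin.ofNat 18 10), (0, Fin.ofNat 18 17), by decide, by decide, by decide,
      ⟨Or.inr rfl, Or.inl rfl, Or.inl rfl⟩, rfl⟩,
    ⟨(0, Fin.ofNat 18 5), (Fin.ofNat 21 3, 0), (Fin.ofNat 21 19, 0), by decide, by decide, by decide,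
      ⟨Or.inl rfl, Or.inr rfl, Or.inr rfl⟩, rfl⟩⟩

end BB

end Literature.InformationTheory.QuantumCodes
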